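import Literature.Computability.Complexity.MurrayWilliams2018SimulationMachineQ
import Literature.Computability.Complexity.MurrayWilliams2018SimulationProofs
import Literature.Computability.Complexity.MurrayWilliams2018EasyWitnessAssemblyQP
import Literature.Computability.Complexity.IKWGeneratorsProofs
import HarnessLib

/-!
# Murray–Williams 2018, Lemma 4.1 in polylogarithmic-seed form: the simulation hypothesis `hsimQ`
# PROVED from the generator of IKW's Theorem 11, and Theorem 1.2 for `AC⁰[m]` from Theorem 3.1 and
# the exponential-level simulation alone

Literature / circuit complexity — derandomization. Sequel of `MurrayWilliams2018SimulationMachineQ.lean`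
(the machine `N` with seeds `c M^{sx}`, `MWSimQN.simLang ∈ NTIME T` for `T ≥ 2^{k (log₂ t + 2)ᵏ}`),
`MurrayWilliams2018SimulationQ.lean` (its correctness on the good lengths, the capped generator
`capGen`) and `MurrayWilliams2018EasyWitnessAssemblyQP.lean` (Lemma 4.1 in polylogarithmic-seed
form and Murray–Williams' Theorem 1.2 for `AC⁰[m]` from `h31`, `hsimQ`, `hN`). This file

* PROVES **`hsimQ_of_thm11`** — the hypothesis `hsimQ` of
  `MurrayWilliams2018_lemma_4_1_qp_of_ingredients` for every referee `Ref ∈ P`, with NO generator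
  hypothesis: the generator is `capGen F` for the `F ∈ FP` of the tree's theorem
  `IKW2002_thm11_tableGenerator` (Impagliazzo–Kabanets–Wigderson 2002, Thm. 11, proved in
  `IKWGeneratorsProofs.lean`; seed `cI · M^{sx}`), the pair language is `MWSimQN.simLang`, the
  constants are `k = (sx + 1) + (cI (A+1) + 1)` (`sx + 1` for the running time, `cI (A+1) + 1` for the
  scale-free hardness requirement `(2 nb)^{cI}` of `isSizePseudorandom_capGen`, `A + 1` the degree
  dominating Arthur's circuits, `MWSimN.exists_exp_dominating`) and `c₀ = 7` (the advice
  `⟨⟨x_h, adv ℓ⟩, 1…1⟩` padded to `7(a+1)ℓ`, as in `MWSimN.hsim_of_umansGenerator`);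
* concludes **`MurrayWilliams2018_lemma_4_1_qp_of_thm31`** /
  **`MurrayWilliams2018_lemma_4_1_qp_of_thm_3_1_universal`** — Lemma 4.1 in polylogarithmic-seed
  form from Theorem 3.1 ALONE (specialised resp. general universal-referee form) — and
  **`MurrayWilliams2018_thm_1_2_acc_of_thm_3_1_universal_of_expSimulation`**: Murray–Williams'
  Theorem 1.2 for `AC⁰[m]` (the named fact `MurrayWilliams2018_thm_1_2_acc`) from Theorem 3.1 in
  universal-referee form and the exponential-level simulation `hN` of
  `MurrayWilliams2018ExpLevel.lean`, nothing else.

After this file the trust base of `MurrayWilliams2018_thm_1_2_acc` (hence of Theorem 1.3 and of the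
headline `NQP ⊄ ACC⁰`) is {Theorem 3.1 of the source in universal-referee form (`h31`), the
exponential-level simulation (`hN`)}: the pseudorandom generator of the printed proof (Umans'
Thm. 2.1) has been replaced by a PROVED one. Nothing is asserted; no named fact is introduced
(D-0026).

## References

* C. D. Murray, R. R. Williams, *Circuit lower bounds for nondeterministic quasi-polytime: an easy
  witness lemma for NP and NQP*, STOC 2018 = SIAM J. Comput. 49(5) (2020), Thm. 2.1, Thm. 3.1,
  proof of Lemma 4.1 (SIAM pp. 314–316), Lemma 1.3, Thm. 1.2 (§5) [MurrayWilliams2018].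
* R. Impagliazzo, V. Kabanets, A. Wigderson, *In search of an easy witness*, JCSS 65 (2002), §2.4,
  Thm. 11, Thm. 12 [ImpagliazzoKabanetsWigderson2002].
* S. Arora, B. Barak, *Computational Complexity: A Modern Approach*, CUP 2009, proof of
  Lemma 20.3, Def. 8.10 [AroraBarakCC2009].
-/

noncomputable section

namespace Literature.Computability.Complexity

open _root_.Computability Turing Finset Filter Polynomial Brick Plumb

namespace MWSimQN

/-! ### The capped generator at seed constant `0` -/

/-- The fooling property of the capped generator without the side condition `1 ≤ cI`: at `cI = 0`
the seed is empty, and either `nb = 0` (a projection) or IKW's hypothesis `(nb + M)^0 < CC(f)` is the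
given `(2 nb)^0 < CC(f)`. [cite: ImpagliazzoKabanetsWigderson2002, Thm. 11] -/
theorem isSizePseudorandom_capGen' {F : List Bool → List Bool} {cI sx : ℕ}
    (hF : ∀ (m n : ℕ) (f : (Fin m → Bool) → Bool), (n + m) ^ cI < circuitSizeOver B2 f →
      IsSizePseudorandom (tableGenerator F f (cI * m ^ sx) n))
    (hsx : 1 ≤ sx) {M nb : ℕ} (f : (Fin M → Bool) → Bool)
    (hf : (2 * nb) ^ cI < circuitSizeOver B2 f) :
    IsSizePseudorandom (tableGenerator (capGen F) f (cI * M ^ sx) nb) := by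
  rcases Nat.eq_zero_or_pos cI with hc | hc
  · subst hc
    rcases le_or_gt nb (0 * M ^ sx) with h | h
    · have e : tableGenerator (capGen F) f (0 * M ^ sx) nb =
          fun (s : Fin (0 * M ^ sx) → Bool) (i : Fin nb) => s (Fin.castLE h i) :=
        funext fun s => funext fun i => tableGenerator_capGen_of_le F f h s i
      rw [e]; exact isSizePseudorandom_proj h
    · rw [tableGenerator_capGen_of_lt F f h]
      exact hF M nb f (by simpa using hf)
  · exact isSizePseudorandom_capGen hF hc hsx f hf

/-! ### The derandomised advice simulation with polylogarithmic seeds (hypothesis `hsimQ`) -/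

/-- Polynomial bookkeeping of the output length: with `u = ℓ + m ℓ ≥ max (A Bᴬ + A) B'`,
`B = 4a + 20`, `B' = (4a + 36)^{cI}`, `|α| ≤ a ℓ`, `ℓ ≥ 1`, the output length
`nb = q(2 L₀) + L₀ + 7`, `L₀ = 2(2ℓ + 2 + |α|) + 2 + m ℓ`, satisfies `(2 nb)^{cI} ≤ u^{cI (A+1) + 1}`.
[folklore] -/
theorem two_mul_nb_pow_le {q : Polynomial ℕ} {A : ℕ}
    (hA : ∀ B u : ℕ, 1 ≤ B → 1 ≤ u → A * B ^ A + A ≤ u → q.eval (B * u) ≤ u ^ (A + 1))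
    {a ℓ mℓ Al cI : ℕ} (hℓ : 1 ≤ ℓ) (hAl : Al ≤ a * ℓ)
    (hu₁ : A * (4 * a + 20) ^ A + A ≤ ℓ + mℓ) (hu₂ : (4 * a + 36) ^ cI ≤ ℓ + mℓ) :
    (2 * (q.eval (2 * (2 * (2 * ℓ + 2 + Al) + 2 + mℓ)) + (2 * (2 * ℓ + 2 + Al) + 2 + mℓ) + 7)) ^ cI ≤
      (ℓ + mℓ) ^ (cI * (A + 1) + 1) := by
  set u := ℓ + mℓ with hu
  have hu1 : 1 ≤ u := by omega
  have hL₀ : 2 * (2 * ℓ + 2 + Al) + 2 + mℓ ≤ (2 * a + 10) * u := by rw [hu]; nlinarith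
  have hq : q.eval (2 * (2 * (2 * ℓ + 2 + Al) + 2 + mℓ)) ≤ u ^ (A + 1) := by
    calc q.eval (2 * (2 * (2 * ℓ + 2 + Al) + 2 + mℓ)) ≤ q.eval ((4 * a + 20) * u) :=
          TM2Iter.eval_mono q (by nlinarith)
      _ ≤ u ^ (A + 1) := hA _ u (by omega) hu1 hu₁
  have hupow : u ≤ u ^ (A + 1) := by
    calc u = u ^ 1 := (pow_one u).symm
      _ ≤ u ^ (A + 1) := Nat.pow_le_pow_right hu1 (by omega)
  have h1pow : 1 ≤ u ^ (A + 1) := Nat.one_le_pow _ _ hu1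
  have hnb : 2 * (q.eval (2 * (2 * (2 * ℓ + 2 + Al) + 2 + mℓ)) + (2 * (2 * ℓ + 2 + Al) + 2 + mℓ) + 7) ≤
      (4 * a + 36) * u ^ (A + 1) := by
    have h2 : (2 * a + 10) * u ≤ (2 * a + 10) * u ^ (A + 1) := Nat.mul_le_mul_left _ hupow
    nlinarith
  calc (2 * (q.eval (2 * (2 * (2 * ℓ + 2 + Al) + 2 + mℓ)) + (2 * (2 * ℓ + 2 + Al) + 2 + mℓ) + 7)) ^ cI
      ≤ ((4 * a + 36) * u ^ (A + 1)) ^ cI := Nat.pow_le_pow_left hnb cI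
    _ = (4 * a + 36) ^ cI * u ^ (cI * (A + 1)) := by rw [mul_pow, ← pow_mul, Nat.mul_comm (A + 1) cI]
    _ ≤ u * u ^ (cI * (A + 1)) := Nat.mul_le_mul_right _ hu₂
    _ = u ^ (cI * (A + 1) + 1) := by ring

/-- **The derandomised advice simulation with polylogarithmic seeds, proved** — hypothesis `hsimQ`
of `MurrayWilliams2018_lemma_4_1_qp_of_ingredients` (`MurrayWilliams2018EasyWitnessAssemblyQP.lean`)
for every referee `Ref ∈ P`. The generator is the capped generator `capGen F` over the `F ∈ FP`
of `IKW2002_thm11_tableGenerator` (seeds `cI · M^{sx}`); the pair language is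
`MWSimQN.simLang (AMTwo.toRefFn ⁻¹' Ref) (capGen F) cI sx QN t m V` with `QN = q ∘ 2X + X + 7` for the
polynomial `q` bounding Arthur's circuits (`MATests.exists_circuit`); `k = (sx+1) + (cI (A+1) + 1)`,
`c₀ = 7`. At a large bad length `n`, for `ℓ ≥ n` under the guard `(ℓ + m ℓ)ᵏ ≤ w n`: the advice is
`⟨⟨x_h, adv ℓ⟩, 1…1⟩` of length `7(a+1)ℓ`; the hardness needed by the capped generator,
`(2 nb)^{cI} ≤ (ℓ + m ℓ)ᵏ ≤ w n < CC(y)` for every accepted admissible witness `y` of `x_h`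
(`two_mul_nb_pow_le`), is supplied by the badness of `x_h`; soundness and completeness are
`MWSimQ.not_mem_simLang_of_rejected` / `MWSimQ.mem_simLang_of_accepted` through
`MWSimQN.mem_simLang_iff_word`, the game values read by `forall_uniformProb_le_of_amValue_le` /
`exists_le_uniformProb_of_le_amValue` and Arthur's predicate on nested pairs by
`MATests.mem_preimage_toRefFn_iff` (`MerlinArthurTests.lean`). (Murray–Williams, proof of Lemma 4.1: "We give a
nondeterministic algorithm `N` such that for all `i` and all inputs of length `nᵢ`, `N` uses
`(2d′+1)nᵢ` bits of advice … and correctly decides `L₁` on all `nᵢ`-bit inputs".)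
[cite: MurrayWilliams2018, Lemma 4.1 (proof)] -/
theorem hsimQ_of_thm11 (Ref : Language Bool) (hRef : Ref ∈ Classes.P) :
    ∃ k c₀ : ℕ, 1 ≤ k ∧
      ∀ (t m : ℕ → ℕ) (a : ℕ), IsTimeConstructible t → Monotone t → IsTimeConstructible m →
        (∀ᶠ n in atTop, m n ≤ t n) →
        ∀ {L : Language Bool} (V : NVerifier t L) (w : ℕ → ℕ) (adv : ℕ → List Bool)
          (L₁ : Language Bool),
          (∀ᶠ n in atTop, (adv n).length ≤ a * n) → AdvisedMAGame Ref m adv L₁ →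
          ∃ N' : Language Bool,
            (∀ T : ℕ → ℕ, (∀ᶠ n in atTop, 2 ^ (k * (Nat.log 2 (t n) + 2) ^ k) ≤ T n) →
              N' ∈ NTIME T) ∧
            ∀ᶠ n in atTop, ∀ xh : List Bool, xh ∈ L → xh.length = n →
              (∀ y : List Bool, y.length ≤ V.c * t xh.length + V.c → V.rel xh y = true →
                w xh.length < stringCC y) →
              ∀ ℓ : ℕ, n ≤ ℓ → (ℓ + m ℓ) ^ k ≤ w n → DecidesOnWithAdvice N' (c₀ * (a + 1)) L₁ ℓ := by
  obtain ⟨F, hF, cI, sx, hsx, h11⟩ := IKW2002_thm11_tableGenerator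
  have hRef' : (AMTwo.toRefFn ⁻¹' Ref : Language Bool) ∈ Classes.P := preimage_mem_P hRef AMTwo.toRefFn_mem_FP
  obtain ⟨q, hq⟩ := MATests.exists_circuit hRef
  obtain ⟨A, hA⟩ := MWSimN.exists_exp_dominating q
  set QN : Polynomial ℕ := q.comp (2 * X) + X + 7 with hQN
  have hNT := exists_simLang_mem_NTIME cI sx QN hsx hRef' (capGen_mem_FP hF)
  refine ⟨sx + 1 + (cI * (A + 1) + 1), 7, by omega,
    fun t m a ht htmono hm hmt L V w adv L₁ hadv hgame => ?_⟩
  refine ⟨simLang (AMTwo.toRefFn ⁻¹' Ref : Language Bool) (capGen F) cI sx QN t m V,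
    fun T hT => hNT t m V ht htmono hm hmt V.one_le_c _ (by omega) T hT, ?_⟩
  obtain ⟨ℓa, hℓa⟩ := eventually_atTop.1 hadv
  refine eventually_atTop.2 ⟨max (max ℓa 7) (max (A * (4 * a + 20) ^ A + A) ((4 * a + 36) ^ cI)),
    fun n hn xh hxL hxn hbad ℓ hnℓ hguard => ?_⟩
  have hℓa' : (adv ℓ).length ≤ a * ℓ := hℓa ℓ (by omega)
  have hℓ7 : 7 ≤ ℓ := by omega
  have hu₁ : A * (4 * a + 20) ^ A + A ≤ ℓ + m ℓ := by omega
  have hu₂ : (4 * a + 36) ^ cI ≤ ℓ + m ℓ := by omega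
  -- the advice, padded to exactly `7 (a + 1) ℓ`
  set α := adv ℓ with hα
  set pad : ℕ := 7 * (a + 1) * ℓ - (2 * (2 * n + 2 + α.length) + 2) with hpad
  set β := boolPair (boolPair xh α) (List.replicate pad true) with hβ
  have hβlen : β.length = 7 * (a + 1) * ℓ := by
    rw [hβ, length_boolPair, length_boolPair, List.length_replicate, hxn, hpad]
    have : 2 * (2 * n + 2 + α.length) + 2 ≤ 7 * (a + 1) * ℓ := by nlinarith
    omega
  refine ⟨β, hβlen, fun x hx => ?_⟩
  rw [hβ, mem_simLang_iff_word]
  -- the parameters of `MWSimQ` at `(x, α)`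
  have hnb : nbLen QN m x.length α.length =
      q.eval (2 * (2 * (2 * ℓ + 2 + α.length) + 2 + m ℓ)) + (2 * (2 * ℓ + 2 + α.length) + 2 + m ℓ) + 7 := by
    simp only [nbLen, hQN, eval_add, eval_comp, eval_mul, eval_X, eval_ofNat, hx]
  have h7 : 7 ≤ nbLen QN m x.length α.length := by rw [hnb]; omega
  have hmnb : m x.length ≤ nbLen QN m x.length α.length := by rw [hnb, hx]; omega
  -- the scale-free hardness level
  set H : ℕ := (2 * nbLen QN m x.length α.length) ^ cI with hH
  have hHk : H ≤ (ℓ + m ℓ) ^ (sx + 1 + (cI * (A + 1) + 1)) := by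
    rw [hH, hnb]
    refine (two_mul_nb_pow_le hA (by omega) hℓa' hu₁ hu₂).trans ?_
    exact Nat.pow_le_pow_right (by omega) (by omega)
  have hbad' : ∀ y : List Bool, y.length ≤ MWSim.bound t V xh.length → V.rel xh y = true →
      H < stringCC y := by
    intro y hy hrel
    have h1 := hbad y hy hrel
    rw [hxn] at h1
    exact lt_of_le_of_lt (hHk.trans hguard) h1
  have hfool : ∀ (M : ℕ) (f : (Fin M → Bool) → Bool), H < circuitSizeOver B2 f →
      IsSizePseudorandom (tableGenerator (capGen F) f (cI * M ^ sx) (nbLen QN m x.length α.length)) :=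
    fun M f hf => isSizePseudorandom_capGen' h11 hsx f (by rw [hH] at hf; exact hf)
  -- Arthur's predicate as circuits of size `≤ nb`
  have hC : ∀ z : List Bool, z.length = m x.length →
      ∃ C : Circuit (Fin (nbLen QN m x.length α.length)), C.IsOver B2 ∧
        C.size ≤ nbLen QN m x.length α.length ∧
        ∀ r, C.eval r = (AMTwo.toRefFn ⁻¹' Ref : Language Bool).boolIndicator (boolPair (boolPair (boolPair x α) z)
          (List.ofFn fun i : Fin (m x.length) => r (Fin.castLE hmnb i))) := by
    intro z hz
    obtain ⟨C, hB, hs, hCe⟩ := hq (boolPair x α) z (m x.length) _ hmnb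
    refine ⟨C, hB, hs.trans ?_, fun r => by rw [hCe, MATests.boolIndicator_preimage_toRefFn]⟩
    rw [hnb, length_boolPair, hz, hx]
    exact ((TM2Iter.eval_mono q (by omega)).trans (Nat.le_add_right _ _)).trans (Nat.le_add_right _ _)
  -- the window covers the honest guesses
  have hU : 2 * MWSim.bound t V xh.length + m x.length + 2 ≤
      MWSimN.window t m V.c (boolPair x (boolPair (boolPair xh α) (List.replicate pad true))) := by
    simp only [MWSimN.window, MWSimN.wlen, MWSimN.xhIn_boolPair, MWSimN.xIn_boolPair, MWSim.bound]
    omega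
  constructor
  · -- completeness
    intro hxL₁
    have hval := (hgame x).1 hxL₁
    rw [hx] at hval
    obtain ⟨z₀, hz₀⟩ := exists_le_uniformProb_of_le_amValue hval
    refine MWSimQ.mem_simLang_of_accepted V cI sx m (nbLen QN m) (MWSimN.window t m V.c) x xh α _ hxL
      hbad' hfool hmnb h7 hC hU ⟨z₀.toList, by rw [List.Vector.toList_length, hx], ?_⟩
    rw [hx]
    convert hz₀ using 2
    ext r
    exact MATests.mem_preimage_toRefFn_iff Ref (boolPair x α) z₀.toList r
  · -- soundness
    intro hmem
    by_contra hxL₁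
    have hval := (hgame x).2 hxL₁
    rw [hx] at hval
    refine MWSimQ.not_mem_simLang_of_rejected V cI sx m (nbLen QN m) (MWSimN.window t m V.c) x xh α _
      hbad' hfool hmnb h7 hC (fun z hz => ?_) hmem
    have h := forall_uniformProb_le_of_amValue_le hval ⟨z, by rw [hz, hx]⟩
    simp only [List.Vector.toList_mk] at h
    rw [hx]
    convert h using 2
    ext r
    exact MATests.mem_preimage_toRefFn_iff Ref (boolPair x α) z r

end MWSimQN

/-! ### Lemma 4.1 in polylogarithmic-seed form, and Theorem 1.2 for `AC⁰[m]`, from Theorem 3.1 -/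

/-- **Murray–Williams 2018, Lemma 4.1 in polylogarithmic-seed form from Theorem 3.1 ALONE**
(specialised universal-referee form `h31` of `MurrayWilliams2018EasyWitnessAssembly.lean`): the
assembly `MurrayWilliams2018_lemma_4_1_qp_of_ingredients` with `hsimQ` discharged by
`MWSimQN.hsimQ_of_thm11`. [cite: MurrayWilliams2018, Lemma 4.1] -/
theorem MurrayWilliams2018_lemma_4_1_qp_of_thm31
    (h31 : ∃ Ref : Language Bool, Ref ∈ Classes.P ∧ ∃ D : ℕ, 1 ≤ D ∧
      ∀ (s : ℕ → ℕ) (D' : ℕ), D * D + D + 2 ≤ D' → StrictMono s → IsTimeConstructible s →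
        (∀ᶠ n in atTop, n * s n ^ 2 < 2 ^ n) →
        ∃ (adv : ℕ → List Bool) (L₁ : Language Bool),
          (∀ n, (adv n).length ≤ D * (Nat.log 2 (s n ^ D') + 1)) ∧
          AdvisedMAGame Ref (mwMoveLen s D D') adv L₁ ∧
          ∀ᶠ n in atTop, s n < L₁.circuitSize n ∨ s (s n ^ D') < L₁.circuitSize (s n ^ D')) :
    ∃ e g d C : ℕ, 1 ≤ e ∧ 1 ≤ g ∧ 1 ≤ d ∧ 1 ≤ C ∧
      ∀ (s t T : ℕ → ℕ), StrictMono s → IsTimeConstructible s → IsTimeConstructible t →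
        Monotone t → IsTimeConstructible T → Monotone T →
        (∀ᶠ n in atTop, n * s n < 2 ^ (n / e)) →
        (∀ᶠ n in atTop, ((stretch s e)^[3] n) ^ d ≤ t n) →
        (∀ᶠ n in atTop, 2 ^ (C * (Nat.log 2 (t n) + 2) ^ C) ≤ T n) →
        (∀ L ∈ NTIME T, ∀ᶠ n in atTop, L.circuitSize n ≤ s n) →
          NTIMEHasWitnessCircuits t (fun n => ((stretch s e)^[3] n) ^ (2 * g)) :=
  MurrayWilliams2018_lemma_4_1_qp_of_ingredients h31 fun Ref hRef => MWSimQN.hsimQ_of_thm11 Ref hRef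

/-- **Lemma 4.1 in polylogarithmic-seed form from Theorem 3.1 in universal-referee form with general
`s₁, s₂`** (eventual generous constraints (i)–(iii), `h31_of_thm_3_1_universal`).
[cite: MurrayWilliams2018, Lemma 4.1] -/
theorem MurrayWilliams2018_lemma_4_1_qp_of_thm_3_1_universal
    (h31 : ∃ Ref : Language Bool, Ref ∈ Classes.P ∧ ∃ D : ℕ, 1 ≤ D ∧
      ∀ (s s₁ s₂ : ℕ → ℕ), StrictMono s → IsTimeConstructible s →
        (∀ᶠ n in atTop, n * s n ^ 2 < 2 ^ n) →
        IsTimeConstructible s₁ → IsTimeConstructible s₂ →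
        (∀ᶠ n in atTop, (n + s n + 2) ^ D ≤ s₂ n) → (∀ᶠ n in atTop, s (s₂ n) ^ D ≤ s₁ n) →
        (∀ᶠ n in atTop, (n + s n + 2) ^ D ≤ s₁ n) →
        ∃ (adv : ℕ → List Bool) (L₁ : Language Bool),
          (∀ n, (adv n).length ≤ D * (Nat.log 2 (s₂ n) + 1)) ∧
          AdvisedMAGame Ref (fun n => (s₁ n * s₂ n) ^ D) adv L₁ ∧
          ∀ᶠ n in atTop, s n < L₁.circuitSize n ∨ s (s₂ n) < L₁.circuitSize (s₂ n)) :
    ∃ e g d C : ℕ, 1 ≤ e ∧ 1 ≤ g ∧ 1 ≤ d ∧ 1 ≤ C ∧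
      ∀ (s t T : ℕ → ℕ), StrictMono s → IsTimeConstructible s → IsTimeConstructible t →
        Monotone t → IsTimeConstructible T → Monotone T →
        (∀ᶠ n in atTop, n * s n < 2 ^ (n / e)) →
        (∀ᶠ n in atTop, ((stretch s e)^[3] n) ^ d ≤ t n) →
        (∀ᶠ n in atTop, 2 ^ (C * (Nat.log 2 (t n) + 2) ^ C) ≤ T n) →
        (∀ L ∈ NTIME T, ∀ᶠ n in atTop, L.circuitSize n ≤ s n) →
          NTIMEHasWitnessCircuits t (fun n => ((stretch s e)^[3] n) ^ (2 * g)) :=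
  MurrayWilliams2018_lemma_4_1_qp_of_ingredients (h31_of_thm_3_1_universal h31) fun Ref hRef =>
    MWSimQN.hsimQ_of_thm11 Ref hRef

/-- **Murray–Williams' Theorem 1.2 for `AC⁰[m]` (`MurrayWilliams2018_thm_1_2_acc`) from Theorem 3.1
in universal-referee form and the exponential-level simulation.** The easy witness lemma for `NQP`
(Lemma 1.3) comes from Lemma 4.1 in polylogarithmic-seed form
(`MurrayWilliams2018_lemma_1_3_of_lemma_4_1_qp`, `MurrayWilliams2018Lemma13QP.lean`), which this file
proves from Theorem 3.1 with the tree's generator; the §5 assembly at the exponential level is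
`MurrayWilliams2018_thm_1_2_acc_of_EWL_of_expSimulation` over the PROVED hierarchy theorem.
[cite: MurrayWilliams2018, Thm. 1.2 (proof, §§3–5)] -/
theorem MurrayWilliams2018_thm_1_2_acc_of_thm_3_1_universal_of_expSimulation
    (h31 : ∃ Ref : Language Bool, Ref ∈ Classes.P ∧ ∃ D : ℕ, 1 ≤ D ∧
      ∀ (s s₁ s₂ : ℕ → ℕ), StrictMono s → IsTimeConstructible s →
        (∀ᶠ n in atTop, n * s n ^ 2 < 2 ^ n) →
        IsTimeConstructible s₁ → IsTimeConstructible s₂ →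
        (∀ᶠ n in atTop, (n + s n + 2) ^ D ≤ s₂ n) → (∀ᶠ n in atTop, s (s₂ n) ^ D ≤ s₁ n) →
        (∀ᶠ n in atTop, (n + s n + 2) ^ D ≤ s₁ n) →
        ∃ (adv : ℕ → List Bool) (L₁ : Language Bool),
          (∀ n, (adv n).length ≤ D * (Nat.log 2 (s₂ n) + 1)) ∧
          AdvisedMAGame Ref (fun n => (s₁ n * s₂ n) ^ D) adv L₁ ∧
          ∀ᶠ n in atTop, s n < L₁.circuitSize n ∨ s (s₂ n) < L₁.circuitSize (s₂ n))
    (hN : ∃ c₀ : ℕ, ∀ (d m k r : ℕ), 2 ≤ m → 1 ≤ k → 2 ≤ r →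
      AccSatSubexp (d + c₀) m r →
      (Classes.P ⊆ ⋃ a : ℕ,
          DepthSizeClass (accBasis m) (fun _ => d) (fun n => a * 2 ^ Nat.log 2 n ^ k + a)) →
      ∃ q : ℕ, 1 ≤ q ∧ ∀ L ∈ NTIME (fun n => 2 ^ n),
        HasWitnessCircuits (fun n => 2 ^ (n ^ 3)) L (fun n => 2 ^ Nat.nthRoot q n) →
        L ∈ NTIME williamsBound) :
    MurrayWilliams2018_thm_1_2_acc :=
  MurrayWilliams2018_thm_1_2_acc_of_lemma_4_1_qp_of_expSimulation
    (MurrayWilliams2018_lemma_4_1_qp_of_thm_3_1_universal h31) hN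

end Literature.Computability.Complexity

end
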